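import Summits.QuantumFields.YangMills.Theorems.LuscherReductionOneSiteLevelsGnForms
import Summits.QuantumFields.YangMills.Theorems.LuscherReductionOneSiteLevelsGaussForm

/-!
# The diagonal pair term, I: the integrand identity and the pointwise curvature-error bound
# (support module for the registered stub `stub_absLower` of crux `OneSiteLevels`, route `LuscherReduction`,
# item stmt-QuantumFields-20007; fleet seat prover ym-luscher-20007-p2)

For `Ψ = G ∘ gnCoord μ` the diagonal pair term of `⟨Ψ, K_B Ψ⟩` (module `…GnForms`) is, exactly,
`T_{σσ} = e^{6B} ∫ Φ(y) e^{−Bμ²‖y−y'‖²} e^{BΣd(y,y')} Φ(y') d(y,y')` with `Φ = c·G·h`, `c = μ⁹(2π²)⁻³`, `h = gnW·gnMag`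
(`gnPairTerm_diag_integrand`).  Writing `e^{BΣd} = 1 + (e^{BΣd} − 1)`:
* the MAIN part is the flat Gaussian form, bounded below by `gaussForm_ge`:
  `∫∫ Φ e^{−B'‖y−y'‖²} Φ' ≥ √(π/B')⁹ (‖Φ‖² − ‖∇Φ‖²/(4B'))`, `B' = Bμ²`;
* the ERROR is controlled in the window `μ²r² ≤ 1/16` by `0 ≤ Σd ≤ μ⁴‖y−y'‖²(‖y‖²+‖y'‖²)`:
  `|Φ||Φ'| e^{−B'‖s‖²}(e^{BΣd} − 1) ≤ μ² (8/(3e)) · ½[(3‖y‖²+2‖s‖²)Φ² + (3‖y'‖²+2‖s‖²)Φ'²] e^{−B'‖s‖²/2}`,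
  whose integral is `μ²(8/(3e))(3 I₀ ∫‖y‖²Φ² + 2 I₂ ∫Φ²)` with the Gaussian moments `I₀ = ∫e^{−B'‖s‖²/2}`, `I₂ = ∫‖s‖²e^{−B'‖s‖²/2}`.
(The integrated bound `gnPairTerm_diag_ge` is in the sequel `…GnDiag`.)

## WHAT THIS IS NOT
Analysis of one integral; NOT the stub, NOT THE CLAY GAP.  Sorry-free, no named fact.
-/

set_option autoImplicit false

noncomputable section

open MeasureTheory Filter Topology Real
open scoped Matrix ENNReal
open Literature.MathematicalPhysics.QuantumFieldTheory
open Literature.MathematicalPhysics.QuantumLattice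
open Literature.Analysis.OperatorTheory.YMMatrixModel

namespace Summit.QuantumFields.YangMills.Theorems.FemtoTransferGap

/-! ### §1. Elementary inequalities -/

/-- The kernel-error estimate: for `0 ≤ x ≤ a/8`, `e^{−a}(e^x − 1) ≤ x e^{−7a/8}`. [folklore] -/
theorem exp_neg_mul_exp_sub_one_le {a x : ℝ} (hx : 0 ≤ x) (hxa : x ≤ a / 8) :
    Real.exp (-a) * (Real.exp x - 1) ≤ x * Real.exp (-(7 / 8) * a) := by
  -- `e^x − 1 ≤ x e^x` (from `1 − x ≤ e^{−x}`; the tree's `AreaLaw.exp_sub_one_le_mul_exp`, re-derived to keep imports light)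
  have h1 : Real.exp x - 1 ≤ x * Real.exp x := by
    have h := Real.add_one_le_exp (-x)
    have hx' := Real.exp_pos x
    have : (-x + 1) * Real.exp x ≤ Real.exp (-x) * Real.exp x := mul_le_mul_of_nonneg_right h hx'.le
    rw [← Real.exp_add, neg_add_cancel, Real.exp_zero] at this
    nlinarith
  have h2 : Real.exp (-a) * (x * Real.exp x) = x * Real.exp (x - a) := by
    rw [Real.exp_sub, Real.exp_neg]; field_simp
  have h3 : x * Real.exp (x - a) ≤ x * Real.exp (-(7 / 8) * a) :=
    mul_le_mul_of_nonneg_left (Real.exp_le_exp.2 (by linarith)) hx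
  calc Real.exp (-a) * (Real.exp x - 1) ≤ Real.exp (-a) * (x * Real.exp x) :=
        mul_le_mul_of_nonneg_left h1 (Real.exp_pos _).le
    _ = x * Real.exp (x - a) := h2
    _ ≤ x * Real.exp (-(7 / 8) * a) := h3

/-- `B' t e^{−(7/8)B' t} ≤ (8/(3e)) e^{−B' t/2}` for `B' > 0`. [folklore] -/
theorem mul_exp_neg_seven_eighths_le {B' t : ℝ} (hB' : 0 < B') :
    B' * t * Real.exp (-(7 / 8) * (B' * t)) ≤ 8 / (3 * Real.exp 1) * Real.exp (-(B' * t) / 2) := by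
  have h := GaussForm.mul_exp_neg_le (a := 3 / 8 * B') (t := t) (by positivity)
  have e : Real.exp (-(7 / 8) * (B' * t)) = Real.exp (-(3 / 8 * B') * t) * Real.exp (-(B' * t) / 2) := by
    rw [← Real.exp_add]; ring_nf
  rw [e, ← mul_assoc]
  refine mul_le_mul_of_nonneg_right ?_ (Real.exp_pos _).le
  have hB0 : B' ≠ 0 := hB'.ne'
  calc B' * t * Real.exp (-(3 / 8 * B') * t) = B' * (t * Real.exp (-(3 / 8 * B') * t)) := by ring
    _ ≤ B' * (Real.exp 1 * (3 / 8 * B'))⁻¹ := mul_le_mul_of_nonneg_left h hB'.le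
    _ = 8 / (3 * Real.exp 1) := by field_simp

/-! ### §2. The diagonal integrand -/

section Diag

variable {B μ : ℝ} {G : ZM → ℝ}

/-- The quasimode integrand `Φ = c · G · h`, `c = μ⁹(2π²)⁻³`, `h = gnW·gnMag`. [folklore] -/
def gnPhi (B μ : ℝ) (G : ZM → ℝ) (y : ZM) : ℝ := μ ^ 9 * ((2 * π ^ 2)⁻¹) ^ 3 * (G y * gnH B μ y)

/-- `Φ² = c² · G² · h²`. [folklore] -/
theorem gnPhi_sq_eq (B μ : ℝ) (G : ZM → ℝ) (y : ZM) :
    gnPhi B μ G y ^ 2 = (μ ^ 9 * ((2 * π ^ 2)⁻¹) ^ 3) ^ 2 * (G y ^ 2 * gnH B μ y ^ 2) := by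
  unfold gnPhi; ring

/-- `Φ² ≤ c² G²` (`0 < h ≤ 1`, `B ≥ 0`). [folklore] -/
theorem gnPhi_sq_le (hB : 0 ≤ B) (μ : ℝ) (G : ZM → ℝ) (y : ZM) :
    gnPhi B μ G y ^ 2 ≤ (μ ^ 9 * ((2 * π ^ 2)⁻¹) ^ 3) ^ 2 * G y ^ 2 := by
  rw [gnPhi_sq_eq]
  refine mul_le_mul_of_nonneg_left ?_ (sq_nonneg _)
  have h0 := (gnH_pos B μ y).le; have h1 := gnH_le_one hB μ y
  have : gnH B μ y ^ 2 ≤ 1 := by nlinarith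
  nlinarith [sq_nonneg (G y)]

/-- Lower bound `Φ² ≥ c² G² ((1 − 12μ²‖y‖²) − 8Bμ⁴V(y))` (from `gnW ≥ 1 − 6μ²‖y‖²`, `gnMag² ≥ 1 − 8Bμ⁴V`). [folklore] -/
theorem gnPhi_sq_ge (hB : 0 ≤ B) (μ : ℝ) (G : ZM → ℝ) (y : ZM) :
    (μ ^ 9 * ((2 * π ^ 2)⁻¹) ^ 3) ^ 2 * (G y ^ 2 * (1 - 12 * (μ ^ 2 * ‖y‖ ^ 2) - 8 * B * μ ^ 4 * luscherPotential y)) ≤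
      gnPhi B μ G y ^ 2 := by
  rw [gnPhi_sq_eq]
  refine mul_le_mul_of_nonneg_left (mul_le_mul_of_nonneg_left ?_ (sq_nonneg _)) (sq_nonneg _)
  have hW : 1 - 6 * (μ ^ 2 * ‖y‖ ^ 2) ≤ gnW μ y := one_sub_le_prod_gnC_sq μ y
  have hW1 : gnW μ y ≤ 1 := gnW_le_one μ y
  have hW0 : 0 ≤ gnW μ y := (gnW_pos μ y).le
  have hM : 1 - 8 * B * μ ^ 4 * luscherPotential y ≤ gnMag B μ y ^ 2 := one_sub_le_gnMag_sq hB μ y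
  have hM1 : gnMag B μ y ^ 2 ≤ 1 := by
    have := gnMag_le_one hB μ y; have := (gnMag_pos B μ y).le; nlinarith
  have hM0 : 0 ≤ gnMag B μ y ^ 2 := sq_nonneg _
  have hV : 0 ≤ 8 * B * μ ^ 4 * luscherPotential y := by have := luscherPotential_nonneg y; positivity
  have ha : 0 ≤ μ ^ 2 * ‖y‖ ^ 2 := by positivity
  -- `gnW² ≥ 1 − 12a` and `h² = gnW² · gnMag² ≥ (1 − 12a)(1 − b)₊ ≥ 1 − 12a − b`
  have hW2 : 1 - 12 * (μ ^ 2 * ‖y‖ ^ 2) ≤ gnW μ y ^ 2 := by nlinarith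
  rw [gnH, mul_pow]
  nlinarith [mul_le_mul_of_nonneg_right hM (sq_nonneg (gnW μ y)), mul_nonneg (sq_nonneg (gnW μ y)) hM0,
    mul_nonneg ha hV, mul_nonneg ha hM0]

/-- **The diagonal integrand identity**: `ρ(y)ρ(y')·G(y)K_B(gnChart σ y, gnChart σ y')G(y') = e^{6B} Φ(y)Φ(y') e^{−Bμ²‖y−y'‖²} e^{BΣd}`.
[folklore] -/
theorem gnPairTerm_diag_integrand (B μ : ℝ) (G : ZM → ℝ) (σ : Fin 3 → Bool) (y y' : ZM) :
    (gnDensityReal μ y * gnDensityReal μ y') * (G y * transferKernel su2Rep B (gnChart μ σ y) (gnChart μ σ y') * G y') =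
      Real.exp (6 * B) * (gnPhi B μ G y * gnPhi B μ G y') * Real.exp (-(B * μ ^ 2 * ‖y - y'‖ ^ 2)) *
        Real.exp (B * ∑ i : Fin 3, gnDefect (fun a => μ * y (i, a)) (fun a => μ * y' (i, a))) := by
  rw [transferKernel_gnChart_same, gnDensityReal_eq, gnDensityReal_eq]
  unfold gnPhi gnH gnMag gnW
  have e : Real.exp (6 * B - B * μ ^ 2 * ‖y - y'‖ ^ 2 + B * ∑ i : Fin 3, gnDefect (fun a => μ * y (i, a)) (fun a => μ * y' (i, a))
      - 4 * B * (gnPot μ y + gnPot μ y')) = Real.exp (6 * B) * Real.exp (-(B * μ ^ 2 * ‖y - y'‖ ^ 2)) *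
      Real.exp (B * ∑ i : Fin 3, gnDefect (fun a => μ * y (i, a)) (fun a => μ * y' (i, a))) *
      (Real.exp (-(4 * B * gnPot μ y)) * Real.exp (-(4 * B * gnPot μ y'))) := by
    rw [← Real.exp_add, ← Real.exp_add, ← Real.exp_add, ← Real.exp_add]; ring_nf
  rw [e]; ring

set_option maxHeartbeats 400000 in
/-- **Pointwise error bound** in the window: if `G` vanishes outside `‖y‖ ≤ r`, `μ²r² ≤ 1/16`, `B > 0`, `μ > 0`, then
`|Φ(y)Φ(y') e^{−B'‖s‖²}(e^{BΣd} − 1)| ≤ μ²(8/(3e))·½[(3‖y‖²+2‖s‖²)Φ(y)² + (3‖y'‖²+2‖s‖²)Φ(y')²] e^{−B'‖s‖²/2}`, `s = y − y'`,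
`B' = Bμ²`. [folklore] -/
theorem abs_diag_error_le (hB : 0 < B) (hμ : 0 < μ) {r : ℝ} (hsupp : ∀ y, G y ≠ 0 → ‖y‖ ≤ r) (hr : μ ^ 2 * r ^ 2 ≤ 1 / 16)
    (y y' : ZM) :
    |gnPhi B μ G y * gnPhi B μ G y' * Real.exp (-(B * μ ^ 2 * ‖y - y'‖ ^ 2)) *
        (Real.exp (B * ∑ i : Fin 3, gnDefect (fun a => μ * y (i, a)) (fun a => μ * y' (i, a))) - 1)| ≤
      μ ^ 2 * (8 / (3 * Real.exp 1)) * ((1 / 2 : ℝ) * ((3 * ‖y‖ ^ 2 + 2 * ‖y - y'‖ ^ 2) * gnPhi B μ G y ^ 2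
        + (3 * ‖y'‖ ^ 2 + 2 * ‖y - y'‖ ^ 2) * gnPhi B μ G y' ^ 2)) * Real.exp (-(B * μ ^ 2 * ‖y - y'‖ ^ 2) / 2) := by
  have hD0 : 0 ≤ ∑ i : Fin 3, gnDefect (fun a => μ * y (i, a)) (fun a => μ * y' (i, a)) := sum_gnDefect_nonneg μ y y'
  have hκ0 : 0 ≤ μ ^ 2 * (8 / (3 * Real.exp 1)) := by positivity
  have hS0 : 0 ≤ (1 / 2 : ℝ) * ((3 * ‖y‖ ^ 2 + 2 * ‖y - y'‖ ^ 2) * gnPhi B μ G y ^ 2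
        + (3 * ‖y'‖ ^ 2 + 2 * ‖y - y'‖ ^ 2) * gnPhi B μ G y' ^ 2) := by positivity
  have hg0 : 0 ≤ Real.exp (-(B * μ ^ 2 * ‖y - y'‖ ^ 2) / 2) := (Real.exp_pos _).le
  have hRHS0 := mul_nonneg (mul_nonneg hκ0 hS0) hg0
  by_cases hy : G y = 0
  · have h0 : gnPhi B μ G y = 0 := by unfold gnPhi; rw [hy]; ring
    have : gnPhi B μ G y * gnPhi B μ G y' * Real.exp (-(B * μ ^ 2 * ‖y - y'‖ ^ 2)) *
        (Real.exp (B * ∑ i : Fin 3, gnDefect (fun a => μ * y (i, a)) (fun a => μ * y' (i, a))) - 1) = 0 := by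
      rw [h0]; ring
    rw [this, abs_zero]; exact hRHS0
  by_cases hy' : G y' = 0
  · have h0 : gnPhi B μ G y' = 0 := by unfold gnPhi; rw [hy']; ring
    have : gnPhi B μ G y * gnPhi B μ G y' * Real.exp (-(B * μ ^ 2 * ‖y - y'‖ ^ 2)) *
        (Real.exp (B * ∑ i : Fin 3, gnDefect (fun a => μ * y (i, a)) (fun a => μ * y' (i, a))) - 1) = 0 := by
      rw [h0]; ring
    rw [this, abs_zero]; exact hRHS0
  have hny : ‖y‖ ≤ r := hsupp y hy
  have hny' : ‖y'‖ ≤ r := hsupp y' hy'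
  have hμy : μ ^ 2 * ‖y‖ ^ 2 ≤ 1 / 16 := le_trans (by nlinarith [pow_le_pow_left₀ (norm_nonneg y) hny 2, sq_nonneg μ]) hr
  have hμy' : μ ^ 2 * ‖y'‖ ^ 2 ≤ 1 / 16 := le_trans (by nlinarith [pow_le_pow_left₀ (norm_nonneg y') hny' 2, sq_nonneg μ]) hr
  have hB'0 : 0 < B * μ ^ 2 := by positivity
  -- `B Σd ≤ (B μ²)‖s‖² · μ²(‖y‖²+‖y'‖²) ≤ (Bμ²)‖s‖²/8`
  have hDle : B * ∑ i : Fin 3, gnDefect (fun a => μ * y (i, a)) (fun a => μ * y' (i, a)) ≤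
      B * μ ^ 2 * ‖y - y'‖ ^ 2 * (μ ^ 2 * (‖y‖ ^ 2 + ‖y'‖ ^ 2)) := by
    have h := mul_le_mul_of_nonneg_left (sum_gnDefect_le μ y y') hB.le
    have e : B * (μ ^ 4 * ‖y - y'‖ ^ 2 * (‖y‖ ^ 2 + ‖y'‖ ^ 2)) = B * μ ^ 2 * ‖y - y'‖ ^ 2 * (μ ^ 2 * (‖y‖ ^ 2 + ‖y'‖ ^ 2)) := by ring
    linarith
  have hsmall : μ ^ 2 * (‖y‖ ^ 2 + ‖y'‖ ^ 2) ≤ 1 / 8 := by nlinarith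
  have hx8 : B * ∑ i : Fin 3, gnDefect (fun a => μ * y (i, a)) (fun a => μ * y' (i, a)) ≤ (B * μ ^ 2 * ‖y - y'‖ ^ 2) / 8 := by
    have : B * μ ^ 2 * ‖y - y'‖ ^ 2 * (μ ^ 2 * (‖y‖ ^ 2 + ‖y'‖ ^ 2)) ≤ B * μ ^ 2 * ‖y - y'‖ ^ 2 * (1 / 8) :=
      mul_le_mul_of_nonneg_left hsmall (by positivity)
    linarith
  -- the kernel error `e^{-B't}(e^{BD} − 1) ≤ μ²(‖y‖²+‖y'‖²) κ e^{-B't/2}`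
  have hker : Real.exp (-(B * μ ^ 2 * ‖y - y'‖ ^ 2)) *
      (Real.exp (B * ∑ i : Fin 3, gnDefect (fun a => μ * y (i, a)) (fun a => μ * y' (i, a))) - 1) ≤
      μ ^ 2 * (‖y‖ ^ 2 + ‖y'‖ ^ 2) * (8 / (3 * Real.exp 1) * Real.exp (-(B * μ ^ 2 * ‖y - y'‖ ^ 2) / 2)) := by
    have h1 := exp_neg_mul_exp_sub_one_le (a := B * μ ^ 2 * ‖y - y'‖ ^ 2) (by positivity) hx8
    have h2 := mul_exp_neg_seven_eighths_le (t := ‖y - y'‖ ^ 2) hB'0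
    have e2 : B * μ ^ 2 * ‖y - y'‖ ^ 2 * Real.exp (-(7 / 8) * (B * μ ^ 2 * ‖y - y'‖ ^ 2)) ≤
        8 / (3 * Real.exp 1) * Real.exp (-(B * μ ^ 2 * ‖y - y'‖ ^ 2) / 2) := by
      have e : B * μ ^ 2 * ‖y - y'‖ ^ 2 = (B * μ ^ 2) * ‖y - y'‖ ^ 2 := by ring
      rw [e]; exact h2
    calc _ ≤ B * (∑ i : Fin 3, gnDefect (fun a => μ * y (i, a)) (fun a => μ * y' (i, a))) *
          Real.exp (-(7 / 8) * (B * μ ^ 2 * ‖y - y'‖ ^ 2)) := h1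
      _ ≤ B * μ ^ 2 * ‖y - y'‖ ^ 2 * (μ ^ 2 * (‖y‖ ^ 2 + ‖y'‖ ^ 2)) * Real.exp (-(7 / 8) * (B * μ ^ 2 * ‖y - y'‖ ^ 2)) :=
          mul_le_mul_of_nonneg_right hDle (Real.exp_pos _).le
      _ = μ ^ 2 * (‖y‖ ^ 2 + ‖y'‖ ^ 2) * (B * μ ^ 2 * ‖y - y'‖ ^ 2 * Real.exp (-(7 / 8) * (B * μ ^ 2 * ‖y - y'‖ ^ 2))) := by ring
      _ ≤ μ ^ 2 * (‖y‖ ^ 2 + ‖y'‖ ^ 2) * (8 / (3 * Real.exp 1) * Real.exp (-(B * μ ^ 2 * ‖y - y'‖ ^ 2) / 2)) :=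
          mul_le_mul_of_nonneg_left e2 (by positivity)
  -- `|Φ||Φ'|(‖y‖²+‖y'‖²) ≤ S`
  have htri : ‖y'‖ ^ 2 ≤ 2 * ‖y‖ ^ 2 + 2 * ‖y - y'‖ ^ 2 := by
    have h1 := norm_sub_le y (y - y')
    rw [sub_sub_cancel] at h1
    have h2 := pow_le_pow_left₀ (norm_nonneg y') h1 2
    nlinarith [sq_nonneg (‖y‖ - ‖y - y'‖)]
  have htri' : ‖y‖ ^ 2 ≤ 2 * ‖y'‖ ^ 2 + 2 * ‖y - y'‖ ^ 2 := by
    have h1 := norm_add_le (y - y') y'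
    rw [sub_add_cancel] at h1
    have h2 := pow_le_pow_left₀ (norm_nonneg y) h1 2
    nlinarith [sq_nonneg (‖y'‖ - ‖y - y'‖)]
  have hprod : |gnPhi B μ G y| * |gnPhi B μ G y'| * (‖y‖ ^ 2 + ‖y'‖ ^ 2) ≤
      (1 / 2 : ℝ) * ((3 * ‖y‖ ^ 2 + 2 * ‖y - y'‖ ^ 2) * gnPhi B μ G y ^ 2 + (3 * ‖y'‖ ^ 2 + 2 * ‖y - y'‖ ^ 2) * gnPhi B μ G y' ^ 2) := by
    have hab : |gnPhi B μ G y| * |gnPhi B μ G y'| ≤ (gnPhi B μ G y ^ 2 + gnPhi B μ G y' ^ 2) / 2 := by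
      nlinarith [sq_nonneg (|gnPhi B μ G y| - |gnPhi B μ G y'|), sq_abs (gnPhi B μ G y), sq_abs (gnPhi B μ G y')]
    have hn : 0 ≤ ‖y‖ ^ 2 + ‖y'‖ ^ 2 := by positivity
    have h1 : (‖y‖ ^ 2 + ‖y'‖ ^ 2) * gnPhi B μ G y ^ 2 ≤ (3 * ‖y‖ ^ 2 + 2 * ‖y - y'‖ ^ 2) * gnPhi B μ G y ^ 2 :=
      mul_le_mul_of_nonneg_right (by linarith) (sq_nonneg _)
    have h2 : (‖y‖ ^ 2 + ‖y'‖ ^ 2) * gnPhi B μ G y' ^ 2 ≤ (3 * ‖y'‖ ^ 2 + 2 * ‖y - y'‖ ^ 2) * gnPhi B μ G y' ^ 2 :=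
      mul_le_mul_of_nonneg_right (by linarith) (sq_nonneg _)
    calc |gnPhi B μ G y| * |gnPhi B μ G y'| * (‖y‖ ^ 2 + ‖y'‖ ^ 2)
        ≤ (gnPhi B μ G y ^ 2 + gnPhi B μ G y' ^ 2) / 2 * (‖y‖ ^ 2 + ‖y'‖ ^ 2) := mul_le_mul_of_nonneg_right hab hn
      _ = (1 / 2 : ℝ) * ((‖y‖ ^ 2 + ‖y'‖ ^ 2) * gnPhi B μ G y ^ 2 + (‖y‖ ^ 2 + ‖y'‖ ^ 2) * gnPhi B μ G y' ^ 2) := by ring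
      _ ≤ _ := by linarith
  -- assemble
  have hE0 : 0 ≤ Real.exp (B * ∑ i : Fin 3, gnDefect (fun a => μ * y (i, a)) (fun a => μ * y' (i, a))) - 1 := by
    have : 1 ≤ Real.exp (B * ∑ i : Fin 3, gnDefect (fun a => μ * y (i, a)) (fun a => μ * y' (i, a))) :=
      Real.one_le_exp (by positivity)
    linarith
  have hPP : 0 ≤ |gnPhi B μ G y| * |gnPhi B μ G y'| := mul_nonneg (abs_nonneg _) (abs_nonneg _)
  rw [abs_mul, abs_mul, abs_mul, abs_of_nonneg (Real.exp_pos (-(B * μ ^ 2 * ‖y - y'‖ ^ 2))).le, abs_of_nonneg hE0]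
  calc |gnPhi B μ G y| * |gnPhi B μ G y'| * Real.exp (-(B * μ ^ 2 * ‖y - y'‖ ^ 2)) *
        (Real.exp (B * ∑ i : Fin 3, gnDefect (fun a => μ * y (i, a)) (fun a => μ * y' (i, a))) - 1)
      = |gnPhi B μ G y| * |gnPhi B μ G y'| * (Real.exp (-(B * μ ^ 2 * ‖y - y'‖ ^ 2)) *
        (Real.exp (B * ∑ i : Fin 3, gnDefect (fun a => μ * y (i, a)) (fun a => μ * y' (i, a))) - 1)) := by ring
    _ ≤ |gnPhi B μ G y| * |gnPhi B μ G y'| * (μ ^ 2 * (‖y‖ ^ 2 + ‖y'‖ ^ 2) *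
        (8 / (3 * Real.exp 1) * Real.exp (-(B * μ ^ 2 * ‖y - y'‖ ^ 2) / 2))) := mul_le_mul_of_nonneg_left hker hPP
    _ = μ ^ 2 * (8 / (3 * Real.exp 1)) * (|gnPhi B μ G y| * |gnPhi B μ G y'| * (‖y‖ ^ 2 + ‖y'‖ ^ 2)) *
        Real.exp (-(B * μ ^ 2 * ‖y - y'‖ ^ 2) / 2) := by ring
    _ ≤ μ ^ 2 * (8 / (3 * Real.exp 1)) * ((1 / 2 : ℝ) * ((3 * ‖y‖ ^ 2 + 2 * ‖y - y'‖ ^ 2) * gnPhi B μ G y ^ 2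
        + (3 * ‖y'‖ ^ 2 + 2 * ‖y - y'‖ ^ 2) * gnPhi B μ G y' ^ 2)) * Real.exp (-(B * μ ^ 2 * ‖y - y'‖ ^ 2) / 2) :=
        mul_le_mul_of_nonneg_right (mul_le_mul_of_nonneg_left hprod hκ0) hg0

end Diag

end Summit.QuantumFields.YangMills.Theorems.FemtoTransferGap

end
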